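import Summits.BirchSwinnertonDyer.BirchSwinnertonDyer.Theorems.SignedBaseChangeTwistPairGreenbergProductDivisibilitySplitAcanchorGlue
import HarnessLib

/-! # Skeleton line `resmc` ("residual anchor": the Greenberg main conjecture modulo `𝔪_{𝒪_{ℂ_p}}` is an
invariant of `ρ̄ = E[p]`) for crux K1′ `TwistPairGreenbergProductDivisibilitySplit` (stmt-BirchSwinnertonDyer-20502),
route SignedBaseChange — crux-strategist `cstrat-stmt-BirchSwinnertonDyer-20502` g1 (2026-08-27).

THE MOVE. The registered line `acanchor` (v2, skeleton of record 19a9c6f03a6f73a0) anchors the two-variable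
Euler-system inclusion `(G) ⊆ ch(X_Gr)·𝒪⟦T₁,T₂⟧` on the ANTICYCLOTOMIC LINE `T₁ = 0` and is stuck on `stub_acDiv`
(the anticyclotomic Eisenstein inclusion at a supersingular prime for ADDITIVE level: Howard–Kolyvagin
Λ-primitivity / a rank-0 converse for level-raised forms, needing `∃ ℓ ∥ N` and square-free `N` in print). This
line anchors the same inclusion on the SPECIAL FIBRE instead: reduce modulo the maximal ideal `𝔪` of `𝒪_{ℂ_p}`,
landing in `k̄⟦T₁⟧⟦T₂⟧` (`k̄ = 𝒪_{ℂ_p}/𝔪 = 𝔽̄_p`), a two-dimensional regular DOMAIN: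
  (ES)    `stub_eulerSystemDivisibility` — VERBATIM the shared stub of `acanchor` (integral two-variable
          Beilinson–Flach/signed Euler-system divisibility `(G) ⊆ ch·𝒪⟦T₁,T₂⟧`);
  (RESμ)  `stub_residualNonvanishing` — `G mod 𝔪 ≠ 0` (some coefficient of `G` is a unit): CLOSABLE BY NAME from
          the guarded fact `BurungaleCastellaSkinner2025.prop422_greenbergAnyRoot_hasUnitContent_minus` (Hsieh's
          `μ(L_BDP) = 0` in Greenberg-frame form gives a unit coefficient already on the line `T₁ = 0`) — the
          reduction `residualNonvanishing_of_prop422` is PROVED below;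
  (RESID) `stub_residualEisensteinInclusion` — LOAD-BEARING: the RESIDUAL Eisenstein inclusion
          `(ch(X_Gr)·𝒪⟦T₁,T₂⟧) mod 𝔪 ⊆ (G mod 𝔪)` in `k̄⟦T₁⟧⟦T₂⟧`.
Then a PROVED residual-rigidity lemma (`le_span_of_residual_anchor`, Nakayama for principal ideals): `I = (c)`,
`G = c·h ∈ I`, `Ī ⊆ (Ḡ)` and `Ḡ ≠ 0` force `h̄·m = 1` in the domain `k̄⟦T₁⟧⟦T₂⟧`, so the constant term of `h` is a
unit of the local ring `𝒪_{ℂ_p}`, `h` is a unit, and `I·𝒪⟦T₁,T₂⟧ = (G)` INTEGRALLY (slack `s = 1`), per factor;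
the product clause, the `∃`-half (landed `stub_frameDataBCSsplit`, p525981) and the twist transport are exactly as in
`acanchor` (landed `Theorems.SignedBaseChangeK1Acanchor.*`, p534867/p536497, cited by name).

WHY THE SPECIAL FIBRE. Unlike the anticyclotomic restriction, the residual inclusion (RESID) depends on `f` only
through `ρ̄_f ≅ E[p]` and the tame level: by residual-Selmer comparison (Greenberg–Vatsal 2000 / Emerton–Pollack–
Weston 2006 Thm. 4.4.x-style, two-variable over `K`: `Sel_Gr(K_∞, E[p])` with `Σ₀`-imprimitive local conditions is
the same object for every newform `g` with `ḡ`-representation `E[p]`; no pseudo-null submodules (Greenberg 2016)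
and `p`-regularity give `char(X_g)/𝔪 = char_{k̄⟦T₁,T₂⟧}(X_g/𝔭)`), and by the congruence of `Σ₀`-imprimitive
two-variable Greenberg/BDP measures (`f ≡ g mod 𝔭` ⇒ `Ḡ_f^{Σ₀} ~ Ḡ_g^{Σ₀}`; Euler factors at `ℓ ≠ p` are nonzero
mod `𝔭`), (RESID) for `f = f_E` FOLLOWS from the full two-variable main conjecture for ONE congruent newform `g`.
Choose `g` by Diamond–Taylor level raising at two primes `q₁, q₂ ∤ pN D_K` INERT in `K` with
`a_{q_i}(f) ≡ ±(q_i+1) (mod p)` (Chebotarev + `Surj`): `g` has level `N q₁ q₂`, is non-ordinary at `p`, satisfies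
the GENERALISED Heegner hypothesis for `K` (`N⁻ = q₁q₂`) and HAS two `q ∥ N_g` non-split in `K` — hypothesis (spl) of
the printed U(3,1)-Eisenstein engine (Castella–Liu–Wan 2022 = BSTW 2024 Thm. 9.24), which is what the package's
Heegner condition denies to `f` itself. On `g`'s side: Eisenstein ⊇ up to vertical slack (CLW at level `N q₁q₂`:
the ONE remaining hypothesis to lift is square-freeness of the `K`-split part `N` — kernel "CLW⁺", shared with
route SignedLowerHalves item 19001), ES(g) (as for `f`), `μ(G_g⁻) = 0` on the Shimura curve `X_{N⁺,q₁q₂}` (Burungale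
2017) ⇒ exact IMC(g) by the `acanchor` squeeze ⇒ (RESID)(g) ⇒ (RESID)(f). HONEST KERNEL: level raising buys
(spl) and the generalised Heegner hypothesis for `g` (the anticyclotomic `μ`-anchor and the U(3,1) non-split prime);
it CANNOT buy square-freeness — for `p ≥ 5` the conductor exponent of `ρ̄` at an additive `ℓ` equals that of `ρ`
(Carayol), so every congruent `g` keeps `ℓ² ∣ N_g`. The Eisenstein input "CLW⁺" (CLW 2022 at non-square-free
`K`-split level) is therefore the kernel of THIS line and ALSO the bottom of `acanchor`'s `stub_acDiv` chain
(Sweeting Thm. 10.2 ⟸ Wan 2015 Thm. 1.3, square-free); the delta is what sits ON TOP of the kernel — residual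
two-variable transport (EPW Cor. 1-style) instead of integral `Λ_ac`-adic ±-Kolyvagin primitivity + control `T₁ → 0`.

`lean check`: sorries ONLY in the three `stub_*`; `TwistPairGreenbergProductDivisibilitySplit_of` concludes K1′
(stmt-20502) BY NAME, and — re-based on route rev 17 (2026-08-27T14:54Z) — `TwistPairGreenbergProductDivisibilityCanonical_of`
concludes the DECIDING crux K1″ (stmt-BirchSwinnertonDyer-20519) BY NAME with (RESμ) discharged from K1″'s own antecedent
`SignedTwoVariableInputs` (TWO open stubs there: ES, RESID). Card: `Lines/resmc.md`. Disproof.lean: none exists for this crux; the landed zero-frame negative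
(`SignedBaseChangeK1ZeroFrame.not_isKatzMeasure₂_zero_of_split`) is honoured — every frame here has `Ω ≠ 0`. -/

-- D-0017: single-problem summit, namespace repeats the problem name by design.
set_option linter.dupNamespace false
set_option autoImplicit false

namespace Summit.BirchSwinnertonDyer.BirchSwinnertonDyer.Cruxes.TwistPairGreenbergProductDivisibilitySplit.Resmc

open Summit.BirchSwinnertonDyer.BirchSwinnertonDyer.Theses.SignedBaseChange
open Summit.BirchSwinnertonDyer.BirchSwinnertonDyer.Theorems
open Literature.NumberTheory.EllipticCurves Literature.NumberTheory.EllipticCurves.ModularForms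
  Literature.NumberTheory.EllipticCurves.BurungaleSkinnerTianWan2024
  Literature.NumberTheory.GaloisRepresentations

/-! ## The three registered stubs -/

/-- stub (ES) — SHARED VERBATIM with line `acanchor`: **two-variable Euler-system divisibility for
`X_Gr(E/K_∞)` at a good prime `p ≥ 5`, classical Heegner `K`, `p` split, `ρ̄_{E,p}` surjective — INTEGRAL, in
K1′'s receptacle:** `(G) ⊆ ch_{Λ_K}(X_Gr(E/K_∞))·𝒪_{ℂ_p}⟦T₁⟧⟦T₂⟧`. Beilinson–Flach classes along the CM Hida
family of `K`, signed Coleman maps at the supersingular `p` (Büyükboduk–Lei arXiv:1605.05310 Thm. 1.2;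
Castella–Çiperiani–Skinner–Sprung arXiv:1804.10993 Thm. 3.7; BSTW arXiv:2409.01350 Prop. 9.18; Loeffler–Zerbes
arXiv:2511.08793). Why it might fail: print is "⊗ ℚ_p / up to exceptional primes" or blanket square-free `N`. -/
theorem stub_eulerSystemDivisibility :
    Literature.NumberTheory.EllipticCurves.ModularForms.nonempty_modularParametrizationData →
    ∀ (W : WeierstrassCurve ℚ) [W.IsElliptic] [W.IsGloballyMinimal] (p : ℕ) [Fact p.Prime], 5 ≤ p →
    W.HasGoodReductionAtPrime p → Literature.NumberTheory.EllipticCurves.Rank1Residual.Surj W p →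
    ∀ (K : Type) [Field K] [NumberField K] (ι : PadicAlgCl p ≃+* ℂ)
      (v vbar : IsDedekindDomain.HeightOneSpectrum (NumberField.RingOfIntegers K))
      (κ₁ κ₂ : ZpExtension K p) (γ₁ γ₂ : Field.absoluteGaloisGroup K)
      [Fact (ZpExtension.IsTopGeneratorPair κ₁ κ₂ γ₁ γ₂)] [NeZero (NumberField.discr K).natAbs]
      (N : ℕ) [NeZero N] (f : CuspForm (CongruenceSubgroup.Gamma0 N) 2),
    IsNewformOf W f → (N : ℤ) = W.conductorNorm ℤ → IsImaginaryQuadratic K →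
    ((Ideal.span {(p : ℤ)}).primesOver (NumberField.RingOfIntegers K)).ncard = 2 →
    ((p : ℕ) : NumberField.RingOfIntegers K) ∈ v.asIdeal →
    ((p : ℕ) : NumberField.RingOfIntegers K) ∈ vbar.asIdeal → vbar ≠ v →
    (∀ (w : NumberField.InfinitePlace K) (k : NumberField.RingOfIntegers K),
      k ∈ v.asIdeal ↔ ‖ι.symm (w.embedding (k : K))‖ < 1) →
    IsCoprime (N : ℤ) (NumberField.discr K) →
    (∀ ℓ : ℕ, ℓ.Prime → ℓ ∣ N → ((Ideal.span {(ℓ : ℤ)}).primesOver (NumberField.RingOfIntegers K)).ncard = 2) →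
    Odd (NumberField.discr K) → NumberField.discr K ≠ -3 →
    κ₁.IsCyclotomic → κ₂.IsAnticyclotomic →
    ∀ (Ω δ : ℂ) (Ωp : (unrIntegers p)ˣ) (LK G : PowerSeries (PowerSeries (PadicComplexInt p))),
      Ω ≠ 0 → (δ ^ 2 = (NumberField.discr K : ℂ) ∨ δ ^ 2 = -(NumberField.discr K : ℂ)) →
      IsKatzMeasure₂ ι v vbar ∅ κ₁ κ₂ γ₁⁻¹ γ₂⁻¹ 1 Ω δ ((Ωp : unrIntegers p) : PadicComplex p) LK →
      IsGreenbergLFunctionAnyRoot₂ ι v vbar κ₁ κ₂ γ₁⁻¹ γ₂⁻¹ f (NumberField.discr K).natAbs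
        (NumberField.classNumber K) LK G →
      ∀ J : ℤ_[p] →+* PadicComplexInt p,
        (∀ x : ℤ_[p], ((J x : PadicComplexInt p) : PadicComplex p) = ((x : ℚ_[p]) : PadicComplex p)) →
        Ideal.span {G} ≤
          (WeierstrassCurve.XGr₂.charIdeal (W.baseChange K) p κ₁ κ₂ vbar γ₁ γ₂).map (IwasawaAlgebra₂.toUnr₂ p J) := by
  sorry

/-- stub (RESμ): **`G mod 𝔪 ≠ 0`** — the Greenberg `p`-adic `L`-function of a genuine frame has a UNIT
coefficient (two-variable `μ = 0` in the weak sense). CLOSABLE BY NAME modulo the guarded fact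
`BurungaleCastellaSkinner2025.prop422_greenbergAnyRoot_hasUnitContent_minus` (Hsieh 2014 Thm. B: a unit
coefficient already among the `[T₁^0 T₂^j] G`), see `residualNonvanishing_of_prop422` below; blocked on that
fact's proof in the tree, nothing else. -/
theorem stub_residualNonvanishing :
    Literature.NumberTheory.EllipticCurves.ModularForms.nonempty_modularParametrizationData →
    ∀ (W : WeierstrassCurve ℚ) [W.IsElliptic] [W.IsGloballyMinimal] (p : ℕ) [Fact p.Prime], 5 ≤ p →
    W.HasGoodReductionAtPrime p → Literature.NumberTheory.EllipticCurves.Rank1Residual.Surj W p →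
    ∀ (K : Type) [Field K] [NumberField K] (ι : PadicAlgCl p ≃+* ℂ)
      (v vbar : IsDedekindDomain.HeightOneSpectrum (NumberField.RingOfIntegers K))
      (κ₁ κ₂ : ZpExtension K p) (γ₁ γ₂ : Field.absoluteGaloisGroup K)
      [Fact (ZpExtension.IsTopGeneratorPair κ₁ κ₂ γ₁ γ₂)] [NeZero (NumberField.discr K).natAbs]
      (N : ℕ) [NeZero N] (f : CuspForm (CongruenceSubgroup.Gamma0 N) 2),
    IsNewformOf W f → (N : ℤ) = W.conductorNorm ℤ → IsImaginaryQuadratic K →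
    ((Ideal.span {(p : ℤ)}).primesOver (NumberField.RingOfIntegers K)).ncard = 2 →
    ((p : ℕ) : NumberField.RingOfIntegers K) ∈ v.asIdeal →
    ((p : ℕ) : NumberField.RingOfIntegers K) ∈ vbar.asIdeal → vbar ≠ v →
    (∀ (w : NumberField.InfinitePlace K) (k : NumberField.RingOfIntegers K),
      k ∈ v.asIdeal ↔ ‖ι.symm (w.embedding (k : K))‖ < 1) →
    IsCoprime (N : ℤ) (NumberField.discr K) →
    (∀ ℓ : ℕ, ℓ.Prime → ℓ ∣ N → ((Ideal.span {(ℓ : ℤ)}).primesOver (NumberField.RingOfIntegers K)).ncard = 2) →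
    Odd (NumberField.discr K) → NumberField.discr K ≠ -3 →
    κ₁.IsCyclotomic → κ₂.IsAnticyclotomic →
    ∀ (Ω δ : ℂ) (Ωp : (unrIntegers p)ˣ) (LK G : PowerSeries (PowerSeries (PadicComplexInt p))),
      Ω ≠ 0 → (δ ^ 2 = (NumberField.discr K : ℂ) ∨ δ ^ 2 = -(NumberField.discr K : ℂ)) →
      IsKatzMeasure₂ ι v vbar ∅ κ₁ κ₂ γ₁⁻¹ γ₂⁻¹ 1 Ω δ ((Ωp : unrIntegers p) : PadicComplex p) LK →
      IsGreenbergLFunctionAnyRoot₂ ι v vbar κ₁ κ₂ γ₁⁻¹ γ₂⁻¹ f (NumberField.discr K).natAbs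
        (NumberField.classNumber K) LK G →
      ∀ J : ℤ_[p] →+* PadicComplexInt p,
        (∀ x : ℤ_[p], ((J x : PadicComplexInt p) : PadicComplex p) = ((x : ℚ_[p]) : PadicComplex p)) →
        PowerSeries.map (PowerSeries.map (IsLocalRing.residue (PadicComplexInt p))) G ≠ 0 := by
  sorry

/-- stub (RESID) — LOAD-BEARING: **the residual Eisenstein inclusion**: modulo the maximal ideal of `𝒪_{ℂ_p}`,
the image of `ch_{Λ_K}(X_Gr(E/K_∞))·𝒪⟦T₁,T₂⟧` lies in `(G mod 𝔪)` in `k̄⟦T₁⟧⟦T₂⟧`. A `ρ̄`-INVARIANT statement: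
for `μ(X_Gr) > 0` it is vacuous, and for `μ = 0` it is the `k̄⟦T₁,T₂⟧`-characteristic ideal of the RESIDUAL Selmer
group `Sel_Gr(K_∞, E[p])` against `G mod 𝔪`, both of which depend on `f` only through `E[p]` and nonzero tame Euler
factors (Greenberg–Vatsal 2000; Emerton–Pollack–Weston 2006 §3–4; Greenberg 2016 (no pseudo-null submodules);
Pollack–Weston 2011 / Castella–Kim–Longo 2017 / Kriz–Li 2019 for congruences of anticyclotomic-BDP measures).
Intended proof: transport from a Diamond–Taylor level-raised congruent newform `g` of level `N q₁ q₂` (`q_i` inert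
in `K`, so (spl) holds and `(g, K)` is generalised Heegner) for which the full two-variable Greenberg IMC follows
from Castella–Liu–Wan 2022 (BSTW arXiv:2409.01350 Thm. 9.24) at NON-square-free `K`-split level ("CLW⁺" — the
kernel), ES(g) and Burungale 2017 (`μ = 0` on Shimura curves). Why it might fail: CLW⁺ (Fourier–Jacobi
coefficients / local doubling integrals at `ℓ² ∣ N`) is not in print; the analytic congruence of two-variable
Greenberg measures across a change of quaternion algebra (`N⁻ = 1` vs `N⁻ = q₁q₂`) carries period ratios
(Ribet–Takahashi / Pollack–Weston / Kim–Ota) that must be `p`-units. -/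
theorem stub_residualEisensteinInclusion :
    Literature.NumberTheory.EllipticCurves.ModularForms.nonempty_modularParametrizationData →
    ∀ (W : WeierstrassCurve ℚ) [W.IsElliptic] [W.IsGloballyMinimal] (p : ℕ) [Fact p.Prime], 5 ≤ p →
    W.HasGoodReductionAtPrime p → Literature.NumberTheory.EllipticCurves.Rank1Residual.Surj W p →
    ∀ (K : Type) [Field K] [NumberField K] (ι : PadicAlgCl p ≃+* ℂ)
      (v vbar : IsDedekindDomain.HeightOneSpectrum (NumberField.RingOfIntegers K))
      (κ₁ κ₂ : ZpExtension K p) (γ₁ γ₂ : Field.absoluteGaloisGroup K)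
      [Fact (ZpExtension.IsTopGeneratorPair κ₁ κ₂ γ₁ γ₂)] [NeZero (NumberField.discr K).natAbs]
      (N : ℕ) [NeZero N] (f : CuspForm (CongruenceSubgroup.Gamma0 N) 2),
    IsNewformOf W f → (N : ℤ) = W.conductorNorm ℤ → IsImaginaryQuadratic K →
    ((Ideal.span {(p : ℤ)}).primesOver (NumberField.RingOfIntegers K)).ncard = 2 →
    ((p : ℕ) : NumberField.RingOfIntegers K) ∈ v.asIdeal →
    ((p : ℕ) : NumberField.RingOfIntegers K) ∈ vbar.asIdeal → vbar ≠ v →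
    (∀ (w : NumberField.InfinitePlace K) (k : NumberField.RingOfIntegers K),
      k ∈ v.asIdeal ↔ ‖ι.symm (w.embedding (k : K))‖ < 1) →
    IsCoprime (N : ℤ) (NumberField.discr K) →
    (∀ ℓ : ℕ, ℓ.Prime → ℓ ∣ N → ((Ideal.span {(ℓ : ℤ)}).primesOver (NumberField.RingOfIntegers K)).ncard = 2) →
    Odd (NumberField.discr K) → NumberField.discr K ≠ -3 →
    κ₁.IsCyclotomic → κ₂.IsAnticyclotomic →
    ∀ (Ω δ : ℂ) (Ωp : (unrIntegers p)ˣ) (LK G : PowerSeries (PowerSeries (PadicComplexInt p))),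
      Ω ≠ 0 → (δ ^ 2 = (NumberField.discr K : ℂ) ∨ δ ^ 2 = -(NumberField.discr K : ℂ)) →
      IsKatzMeasure₂ ι v vbar ∅ κ₁ κ₂ γ₁⁻¹ γ₂⁻¹ 1 Ω δ ((Ωp : unrIntegers p) : PadicComplex p) LK →
      IsGreenbergLFunctionAnyRoot₂ ι v vbar κ₁ κ₂ γ₁⁻¹ γ₂⁻¹ f (NumberField.discr K).natAbs
        (NumberField.classNumber K) LK G →
      ∀ J : ℤ_[p] →+* PadicComplexInt p,
        (∀ x : ℤ_[p], ((J x : PadicComplexInt p) : PadicComplex p) = ((x : ℚ_[p]) : PadicComplex p)) →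
        ((WeierstrassCurve.XGr₂.charIdeal (W.baseChange K) p κ₁ κ₂ vbar γ₁ γ₂).map (IwasawaAlgebra₂.toUnr₂ p J)).map
            (PowerSeries.map (PowerSeries.map (IsLocalRing.residue (PadicComplexInt p)))) ≤
          Ideal.span {PowerSeries.map (PowerSeries.map (IsLocalRing.residue (PadicComplexInt p))) G} := by
  sorry

/-! ## Proved glue I: residual rigidity (Nakayama for principal ideals of `R⟦T₁⟧⟦T₂⟧`, `R` local) -/

section Rigidity

variable {R : Type*} [CommRing R] [IsLocalRing R]

/-- **Residual rigidity.** `R` a local ring with residue field `k`, `I = (c) ⊆ R⟦T₂⟧⟦T₁⟧` principal, `G ∈ I`,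
`I mod 𝔪 ⊆ (G mod 𝔪)` in `k⟦T₂⟧⟦T₁⟧` and `G mod 𝔪 ≠ 0`. Then `I ⊆ (G)` (hence `I = (G)`): writing `G = c·h`,
`c̄ = c̄·h̄·m` in the DOMAIN `k⟦T₂⟧⟦T₁⟧` with `c̄ ≠ 0` gives `h̄·m = 1`, so the constant term of `h` is a unit
of `R` (residue of a unit) and `h` is a unit. -/
theorem le_span_of_residual_anchor
    {I : Ideal (PowerSeries (PowerSeries R))} {G : PowerSeries (PowerSeries R)}
    (hI : I.IsPrincipal) (hG : G ∈ I)
    (hanch : I.map (PowerSeries.map (PowerSeries.map (IsLocalRing.residue R))) ≤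
      Ideal.span {PowerSeries.map (PowerSeries.map (IsLocalRing.residue R)) G})
    (hne : PowerSeries.map (PowerSeries.map (IsLocalRing.residue R)) G ≠ 0) :
    I ≤ Ideal.span {G} := by
  set φ : PowerSeries (PowerSeries R) →+* PowerSeries (PowerSeries (IsLocalRing.ResidueField R)) :=
    PowerSeries.map (PowerSeries.map (IsLocalRing.residue R)) with hφ
  obtain ⟨⟨c, hc⟩⟩ := hI
  have hc' : I = Ideal.span {c} := hc
  subst hc'
  obtain ⟨h, hGh⟩ := Ideal.mem_span_singleton.mp hG
  subst hGh
  have hcm : φ c ∈ Ideal.span {φ (c * h)} :=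
    hanch (Ideal.mem_map_of_mem _ (Ideal.mem_span_singleton_self c))
  obtain ⟨m, hm⟩ := Ideal.mem_span_singleton.mp hcm
  rw [map_mul] at hm hne
  have hc0 : φ c ≠ 0 := left_ne_zero_of_mul hne
  have h1 : φ h * m = 1 :=
    mul_left_cancel₀ hc0 (by rw [← mul_assoc, ← hm, mul_one])
  have hφh : IsUnit (φ h) := IsUnit.of_mul_eq_one m h1
  have hu : IsUnit h := by
    rw [PowerSeries.isUnit_iff_constantCoeff, PowerSeries.isUnit_iff_constantCoeff] at hφh ⊢
    have key : PowerSeries.constantCoeff (PowerSeries.constantCoeff (φ h)) =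
        IsLocalRing.residue R (PowerSeries.constantCoeff (PowerSeries.constantCoeff h)) := by
      simp only [hφ, ← PowerSeries.coeff_zero_eq_constantCoeff_apply, PowerSeries.coeff_map]
    rw [key] at hφh
    exact (isUnit_map_iff (IsLocalRing.residue R) _).mp hφh
  exact Ideal.span_singleton_le_span_singleton.mpr ⟨↑hu.unit⁻¹, by rw [mul_assoc, IsUnit.mul_val_inv, mul_one]⟩

/-- A unit coefficient survives reduction: if some `[T₁^0 T₂^j] G` is a unit of `R` then `G mod 𝔪 ≠ 0`. -/
theorem map_residue_ne_zero_of_isUnit_coeff {G : PowerSeries (PowerSeries R)} {j : ℕ}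
    (hj : IsUnit (PowerSeries.coeff j (PowerSeries.coeff 0 G))) :
    PowerSeries.map (PowerSeries.map (IsLocalRing.residue R)) G ≠ 0 := by
  intro h0
  have := congrArg (fun F ↦ PowerSeries.coeff j (PowerSeries.coeff 0 F)) h0
  simp only [PowerSeries.coeff_map, map_zero] at this
  have hu : IsUnit (IsLocalRing.residue R (PowerSeries.coeff j (PowerSeries.coeff 0 G))) := hj.map _
  rw [this] at hu
  exact not_isUnit_zero hu

end Rigidity

/-- **Residual rigidity in K1′'s receptacle.** For a principal ideal `I ⊆ Λ_K` and a structure map `J`: the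
Euler-system inclusion `(G) ⊆ I·𝒪⟦T₁,T₂⟧`, the residual anchor `(I·𝒪⟦T₁,T₂⟧) mod 𝔪 ⊆ (G mod 𝔪)` and
`G mod 𝔪 ≠ 0` give the integral Eisenstein inclusion `I·𝒪⟦T₁,T₂⟧ ⊆ (G)`. -/
theorem map_le_span_of_residual_anchor {p : ℕ} [Fact p.Prime] {I : Ideal (IwasawaAlgebra₂ p)}
    (hI : I.IsPrincipal) (J : ℤ_[p] →+* PadicComplexInt p) {G : PowerSeries (PowerSeries (PadicComplexInt p))}
    (hES : Ideal.span {G} ≤ I.map (IwasawaAlgebra₂.toUnr₂ p J))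
    (hres : (I.map (IwasawaAlgebra₂.toUnr₂ p J)).map
        (PowerSeries.map (PowerSeries.map (IsLocalRing.residue (PadicComplexInt p)))) ≤
      Ideal.span {PowerSeries.map (PowerSeries.map (IsLocalRing.residue (PadicComplexInt p))) G})
    (hne : PowerSeries.map (PowerSeries.map (IsLocalRing.residue (PadicComplexInt p))) G ≠ 0) :
    I.map (IwasawaAlgebra₂.toUnr₂ p J) ≤ Ideal.span {G} := by
  have hP : (I.map (IwasawaAlgebra₂.toUnr₂ p J)).IsPrincipal := by
    obtain ⟨⟨c, hc⟩⟩ := hI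
    have hc' : I = Ideal.span {c} := hc
    refine ⟨⟨IwasawaAlgebra₂.toUnr₂ p J c, ?_⟩⟩
    rw [hc', Ideal.map_span, Set.image_singleton]
  exact le_span_of_residual_anchor hP (hES (Ideal.mem_span_singleton_self G)) hres hne

/-! ## Proved glue II: (RESμ) BY NAME modulo the guarded fact BCS 2025 Prop. 4.2.2 (v2) -/

/-- **RESμ ⇐ `BurungaleCastellaSkinner2025.prop422_greenbergAnyRoot_hasUnitContent_minus`, BY NAME** (same
shape as the landed `SignedBaseChangeK1Acanchor.acMu_of_prop422`): the named fact gives a unit among the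
coefficients `[T₂^j] G⁻ = [T₁^0 T₂^j] G`, hence `G mod 𝔪 ≠ 0`. (irr_K) from `Surj` (`Rank1Residual.irrK_of_surj`). -/
theorem residualNonvanishing_of_prop422
    (h422 : Literature.NumberTheory.EllipticCurves.BurungaleCastellaSkinner2025.prop422_greenbergAnyRoot_hasUnitContent_minus) :
    Literature.NumberTheory.EllipticCurves.ModularForms.nonempty_modularParametrizationData →
    ∀ (W : WeierstrassCurve ℚ) [W.IsElliptic] [W.IsGloballyMinimal] (p : ℕ) [Fact p.Prime], 5 ≤ p →
    W.HasGoodReductionAtPrime p → Literature.NumberTheory.EllipticCurves.Rank1Residual.Surj W p →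
    ∀ (K : Type) [Field K] [NumberField K] (ι : PadicAlgCl p ≃+* ℂ)
      (v vbar : IsDedekindDomain.HeightOneSpectrum (NumberField.RingOfIntegers K))
      (κ₁ κ₂ : ZpExtension K p) (γ₁ γ₂ : Field.absoluteGaloisGroup K)
      [Fact (ZpExtension.IsTopGeneratorPair κ₁ κ₂ γ₁ γ₂)] [NeZero (NumberField.discr K).natAbs]
      (N : ℕ) [NeZero N] (f : CuspForm (CongruenceSubgroup.Gamma0 N) 2),
    IsNewformOf W f → (N : ℤ) = W.conductorNorm ℤ → IsImaginaryQuadratic K →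
    ((Ideal.span {(p : ℤ)}).primesOver (NumberField.RingOfIntegers K)).ncard = 2 →
    ((p : ℕ) : NumberField.RingOfIntegers K) ∈ v.asIdeal →
    ((p : ℕ) : NumberField.RingOfIntegers K) ∈ vbar.asIdeal → vbar ≠ v →
    (∀ (w : NumberField.InfinitePlace K) (k : NumberField.RingOfIntegers K),
      k ∈ v.asIdeal ↔ ‖ι.symm (w.embedding (k : K))‖ < 1) →
    IsCoprime (N : ℤ) (NumberField.discr K) →
    (∀ ℓ : ℕ, ℓ.Prime → ℓ ∣ N → ((Ideal.span {(ℓ : ℤ)}).primesOver (NumberField.RingOfIntegers K)).ncard = 2) →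
    Odd (NumberField.discr K) → NumberField.discr K ≠ -3 →
    κ₁.IsCyclotomic → κ₂.IsAnticyclotomic →
    ∀ (Ω δ : ℂ) (Ωp : (unrIntegers p)ˣ) (LK G : PowerSeries (PowerSeries (PadicComplexInt p))),
      Ω ≠ 0 → (δ ^ 2 = (NumberField.discr K : ℂ) ∨ δ ^ 2 = -(NumberField.discr K : ℂ)) →
      IsKatzMeasure₂ ι v vbar ∅ κ₁ κ₂ γ₁⁻¹ γ₂⁻¹ 1 Ω δ ((Ωp : unrIntegers p) : PadicComplex p) LK →
      IsGreenbergLFunctionAnyRoot₂ ι v vbar κ₁ κ₂ γ₁⁻¹ γ₂⁻¹ f (NumberField.discr K).natAbs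
        (NumberField.classNumber K) LK G →
      ∀ J : ℤ_[p] →+* PadicComplexInt p,
        (∀ x : ℤ_[p], ((J x : PadicComplexInt p) : PadicComplex p) = ((x : ℚ_[p]) : PadicComplex p)) →
        PowerSeries.map (PowerSeries.map (IsLocalRing.residue (PadicComplexInt p))) G ≠ 0 := by
  intro hmodP W _ _ p _ hp hgood hs K _ _ ι v vbar κ₁ κ₂ γ₁ γ₂ _ _ N _ f hf hN hK hsplit hv hvbar hvv hι
    hcop hHeeg hodd hne3 hκ₁ hκ₂ Ω δ Ωp LK G hΩ hδ hLK hG J hJ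
  have hp2 : 2 < p := by omega
  have hirr : (W.baseChange K).HasIrreducibleModPGaloisRep p :=
    Summit.BirchSwinnertonDyer.Rank1Residual.irrK_of_surj W p hs K hK.1
  obtain ⟨n, hn⟩ := h422 ι W K v vbar κ₁ κ₂ γ₁ γ₂ hf hN hp2 hgood hK hHeeg hsplit hodd hne3 hcop hirr hv hvbar
    hvv hι hκ₁ hκ₂ Ω δ Ωp LK G hΩ hδ hLK hG
  rw [UnrSeries₂.coeff_minus] at hn
  exact map_residue_ne_zero_of_isUnit_coeff hn

/-! ## The composition: K1′ by name -/

/-- composition: FD⁺ (landed `stub_frameDataBCSsplit`) supplies the package; per factor (ES) + (RESID) + (RESμ) +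
principality (`SignedBaseChangeK1Acanchor.charIdealIsPrincipal₂`, landed) + residual rigidity give the integral
inclusion `ch ⊆ (G)`; surjectivity, good reduction, `(N′, D_K) = 1` and Heegner for the twist are the landed
`SignedBaseChangeK1Acanchor` / `SignedBaseChangeK2RFrames` lemmas; the product clause of K1′ holds with `s = 1`. -/
theorem TwistPairGreenbergProductDivisibilitySplit_of :
    Summit.BirchSwinnertonDyer.BirchSwinnertonDyer.Theses.SignedBaseChange.TwistPairGreenbergProductDivisibilitySplit := by
  intro hmodP W _ _ p _ hp hX hs
  obtain ⟨K, iF, iNF, ι, v, vbar, κ₁, κ₂, γ₁, γ₂, iPair, iD, N, iN, f, d, W', iE', iM', C, N', iN', f',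
      h0, h1, h2, h3, h4, h5, h6, h7, h8, h9, h10, h11, h12, h13, h14, h15, h16, h17,
      e1, e2, e3, e4, e5, e6, e7⟩ :=
    Summit.BirchSwinnertonDyer.BirchSwinnertonDyer.Theorems.SignedBaseChangeK1FrameDataBCSSplit.stub_frameDataBCSsplit
      hmodP W p hp hX hs
  -- per-factor hypotheses for `W` and for the twist `W'`
  have hgood : W.HasGoodReductionAtPrime p := hX.1.1
  have hgood' : W'.HasGoodReductionAtPrime p :=
    Summit.BirchSwinnertonDyer.BirchSwinnertonDyer.Theorems.SignedBaseChangeK2RFrames.hasGoodReductionAtPrime_of_smul_eq_quadraticTwist_of_not_ramifiedInQuadratic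
      W W' h7 Fact.out hgood (fun hr ↦ (h6 p Fact.out hr).1 rfl)
  have hs' : Literature.NumberTheory.EllipticCurves.Rank1Residual.Surj W' p :=
    SignedBaseChangeK1Acanchor.surj_of_smul_eq_quadraticTwist W W' p h5 h7 hs
  have h14' : IsCoprime (N' : ℤ) (NumberField.discr K) :=
    Summit.BirchSwinnertonDyer.BirchSwinnertonDyer.Theorems.SignedBaseChangeK2RFrames.isCoprime_conductorNorm_twist_discr
      W W' h7 h1 h3 (fun q hq hr ↦ ⟨(h6 q hq hr).2.1, (h6 q hq hr).2.2⟩) h14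
  have e1' := SignedBaseChangeK1Acanchor.heegner_twist W W' h7 h1 h3 (K := K) e1 e5 e2
  refine ⟨K, iF, iNF, ι, v, vbar, κ₁, κ₂, γ₁, γ₂, iPair, iD, N, iN, f, d, W', iE', iM', C, N', iN', f',
    h0, h1, h2, h3, h4, h5, h6, h7, h8, h9, h10, h11, h12, h13, h14, e1, e5, e2, h15, h16, h17, ?_⟩
  intro Ω δ Ωp LK G G' hΩ hδ hLK hG hG' J hJ
  have hA : (WeierstrassCurve.XGr₂.charIdeal (W.baseChange K) p κ₁ κ₂ vbar γ₁ γ₂).map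
      (IwasawaAlgebra₂.toUnr₂ p J) ≤ Ideal.span {G} :=
    map_le_span_of_residual_anchor (SignedBaseChangeK1Acanchor.charIdealIsPrincipal₂ p _) J
      (stub_eulerSystemDivisibility hmodP W p hp hgood hs K ι v vbar κ₁ κ₂ γ₁ γ₂ N f h0 h1 h8 h9 h10
        h11 h12 h13 h14 e1 e3.1 e3.2 h16 h17 Ω δ Ωp LK G hΩ hδ hLK hG J hJ)
      (stub_residualEisensteinInclusion hmodP W p hp hgood hs K ι v vbar κ₁ κ₂ γ₁ γ₂ N f h0 h1 h8 h9 h10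
        h11 h12 h13 h14 e1 e3.1 e3.2 h16 h17 Ω δ Ωp LK G hΩ hδ hLK hG J hJ)
      (stub_residualNonvanishing hmodP W p hp hgood hs K ι v vbar κ₁ κ₂ γ₁ γ₂ N f h0 h1 h8 h9 h10
        h11 h12 h13 h14 e1 e3.1 e3.2 h16 h17 Ω δ Ωp LK G hΩ hδ hLK hG J hJ)
  have hB : (WeierstrassCurve.XGr₂.charIdeal (W'.baseChange K) p κ₁ κ₂ vbar γ₁ γ₂).map
      (IwasawaAlgebra₂.toUnr₂ p J) ≤ Ideal.span {G'} :=
    map_le_span_of_residual_anchor (SignedBaseChangeK1Acanchor.charIdealIsPrincipal₂ p _) J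
      (stub_eulerSystemDivisibility hmodP W' p hp hgood' hs' K ι v vbar κ₁ κ₂ γ₁ γ₂ N' f' h2 h3 h8 h9
        h10 h11 h12 h13 h14' e1' e3.1 e3.2 h16 h17 Ω δ Ωp LK G' hΩ hδ hLK hG' J hJ)
      (stub_residualEisensteinInclusion hmodP W' p hp hgood' hs' K ι v vbar κ₁ κ₂ γ₁ γ₂ N' f' h2 h3 h8 h9
        h10 h11 h12 h13 h14' e1' e3.1 e3.2 h16 h17 Ω δ Ωp LK G' hΩ hδ hLK hG' J hJ)
      (stub_residualNonvanishing hmodP W' p hp hgood' hs' K ι v vbar κ₁ κ₂ γ₁ γ₂ N' f' h2 h3 h8 h9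
        h10 h11 h12 h13 h14' e1' e3.1 e3.2 h16 h17 Ω δ Ωp LK G' hΩ hδ hLK hG' J hJ)
  exact ⟨1, one_ne_zero, SignedBaseChangeK1Acanchor.span_C_one_mul_mul_le hA hB⟩

/-! ## The composition re-based on rev 17 (2026-08-27T14:54Z): the DECIDING crux K1″ by name, TWO open stubs

Since rev 14″/17 the deciding crux of the route is K1″ = `TwistPairGreenbergProductDivisibilityCanonical`
(stmt-BirchSwinnertonDyer-20519) = `SignedTwoVariableInputs →` K1′-text with the extra «γ₁ canonical» conjunct, and
K1′ (stmt-20502, concluded above) is an aside. The antecedent `SignedTwoVariableInputs` CONTAINS the guarded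
BCS 2025 Prop. 4.2.2 (v2), so on K1″ the stub (RESμ) is DISCHARGED by `residualNonvanishing_of_prop422` and the line
has exactly two open stubs: (ES) `stub_eulerSystemDivisibility` and (RESID) `stub_residualEisensteinInclusion`.
The `∃`-half is the landed FD″ `SignedBaseChangeK1FrameDataCanonical.stub_frameDataBCSsplit_canonical` (p533831). -/

/-- composition for K1″: `SignedTwoVariableInputs` ⊢ Prop. 4.2.2 v2 ⊢ (RESμ); then as for K1′ with FD″ and `hcan` threaded. -/
theorem TwistPairGreenbergProductDivisibilityCanonical_of :
    Summit.BirchSwinnertonDyer.BirchSwinnertonDyer.Theses.SignedBaseChange.TwistPairGreenbergProductDivisibilityCanonical := by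
  intro hIn hmodP W _ _ p _ hp hX hs
  have h422 : Literature.NumberTheory.EllipticCurves.BurungaleCastellaSkinner2025.prop422_greenbergAnyRoot_hasUnitContent_minus :=
    (show Literature.NumberTheory.EllipticCurves.BurungaleCastellaSkinner2025.prop422_greenbergAnyRoot_hasUnitContent_minus ∧
        Literature.NumberTheory.EllipticCurves.BurungaleSkinnerTianWan2024.props118_27_519_exists_signedTwoVariablePackage_supersingular_PRE
      from hIn).1
  obtain ⟨K, iF, iNF, ι, v, vbar, κ₁, κ₂, γ₁, γ₂, iPair, iD, N, iN, f, d, W', iE', iM', C, N', iN', f',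
      h0, h1, h2, h3, h4, h5, h6, h7, h8, h9, h10, h11, h12, h13, h14, h15, h16, h17, hcan,
      e1, e2, e3, e4, e5, e6, e7⟩ :=
    Summit.BirchSwinnertonDyer.BirchSwinnertonDyer.Theorems.SignedBaseChangeK1FrameDataCanonical.stub_frameDataBCSsplit_canonical
      hmodP W p hp hX hs
  have hgood : W.HasGoodReductionAtPrime p := hX.1.1
  have hgood' : W'.HasGoodReductionAtPrime p :=
    Summit.BirchSwinnertonDyer.BirchSwinnertonDyer.Theorems.SignedBaseChangeK2RFrames.hasGoodReductionAtPrime_of_smul_eq_quadraticTwist_of_not_ramifiedInQuadratic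
      W W' h7 Fact.out hgood (fun hr ↦ (h6 p Fact.out hr).1 rfl)
  have hs' : Literature.NumberTheory.EllipticCurves.Rank1Residual.Surj W' p :=
    SignedBaseChangeK1Acanchor.surj_of_smul_eq_quadraticTwist W W' p h5 h7 hs
  have h14' : IsCoprime (N' : ℤ) (NumberField.discr K) :=
    Summit.BirchSwinnertonDyer.BirchSwinnertonDyer.Theorems.SignedBaseChangeK2RFrames.isCoprime_conductorNorm_twist_discr
      W W' h7 h1 h3 (fun q hq hr ↦ ⟨(h6 q hq hr).2.1, (h6 q hq hr).2.2⟩) h14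
  have e1' := SignedBaseChangeK1Acanchor.heegner_twist W W' h7 h1 h3 (K := K) e1 e5 e2
  refine ⟨K, iF, iNF, ι, v, vbar, κ₁, κ₂, γ₁, γ₂, iPair, iD, N, iN, f, d, W', iE', iM', C, N', iN', f',
    h0, h1, h2, h3, h4, h5, h6, h7, h8, h9, h10, h11, h12, h13, h14, e1, e5, e2, h15, h16, h17, hcan, ?_⟩
  intro Ω δ Ωp LK G G' hΩ hδ hLK hG hG' J hJ
  have hA : (WeierstrassCurve.XGr₂.charIdeal (W.baseChange K) p κ₁ κ₂ vbar γ₁ γ₂).map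
      (IwasawaAlgebra₂.toUnr₂ p J) ≤ Ideal.span {G} :=
    map_le_span_of_residual_anchor (SignedBaseChangeK1Acanchor.charIdealIsPrincipal₂ p _) J
      (stub_eulerSystemDivisibility hmodP W p hp hgood hs K ι v vbar κ₁ κ₂ γ₁ γ₂ N f h0 h1 h8 h9 h10
        h11 h12 h13 h14 e1 e3.1 e3.2 h16 h17 Ω δ Ωp LK G hΩ hδ hLK hG J hJ)
      (stub_residualEisensteinInclusion hmodP W p hp hgood hs K ι v vbar κ₁ κ₂ γ₁ γ₂ N f h0 h1 h8 h9 h10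
        h11 h12 h13 h14 e1 e3.1 e3.2 h16 h17 Ω δ Ωp LK G hΩ hδ hLK hG J hJ)
      (residualNonvanishing_of_prop422 h422 hmodP W p hp hgood hs K ι v vbar κ₁ κ₂ γ₁ γ₂ N f h0 h1 h8 h9
        h10 h11 h12 h13 h14 e1 e3.1 e3.2 h16 h17 Ω δ Ωp LK G hΩ hδ hLK hG J hJ)
  have hB : (WeierstrassCurve.XGr₂.charIdeal (W'.baseChange K) p κ₁ κ₂ vbar γ₁ γ₂).map
      (IwasawaAlgebra₂.toUnr₂ p J) ≤ Ideal.span {G'} :=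
    map_le_span_of_residual_anchor (SignedBaseChangeK1Acanchor.charIdealIsPrincipal₂ p _) J
      (stub_eulerSystemDivisibility hmodP W' p hp hgood' hs' K ι v vbar κ₁ κ₂ γ₁ γ₂ N' f' h2 h3 h8 h9
        h10 h11 h12 h13 h14' e1' e3.1 e3.2 h16 h17 Ω δ Ωp LK G' hΩ hδ hLK hG' J hJ)
      (stub_residualEisensteinInclusion hmodP W' p hp hgood' hs' K ι v vbar κ₁ κ₂ γ₁ γ₂ N' f' h2 h3 h8 h9
        h10 h11 h12 h13 h14' e1' e3.1 e3.2 h16 h17 Ω δ Ωp LK G' hΩ hδ hLK hG' J hJ)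
      (residualNonvanishing_of_prop422 h422 hmodP W' p hp hgood' hs' K ι v vbar κ₁ κ₂ γ₁ γ₂ N' f' h2 h3
        h8 h9 h10 h11 h12 h13 h14' e1' e3.1 e3.2 h16 h17 Ω δ Ωp LK G' hΩ hδ hLK hG' J hJ)
  exact ⟨1, one_ne_zero, SignedBaseChangeK1Acanchor.span_C_one_mul_mul_le hA hB⟩


/-! ## Rev 19 (15:2xZ): K1″ is SPLIT along `acanchor` into the ES child `TwoVariableEulerSystemDivisibility`
(stmt-BirchSwinnertonDyer-20577) + `AnticyclotomicEisensteinDivisibility` (stmt-20576). Line `resmc` consumes the ES CHILD BY NAME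
and replaces the anticyclotomic child by (RESID): given item 20577, exactly ONE open stub remains on this line. -/

/-- K1″ ⇐ the route's ES child item (stmt-20577, by name) + (RESID) [+ (RESμ) discharged from `SignedTwoVariableInputs`]. -/
theorem TwistPairGreenbergProductDivisibilityCanonical_of_esChild
    (hESc : Summit.BirchSwinnertonDyer.BirchSwinnertonDyer.Theses.SignedBaseChange.TwoVariableEulerSystemDivisibility) :
    Summit.BirchSwinnertonDyer.BirchSwinnertonDyer.Theses.SignedBaseChange.TwistPairGreenbergProductDivisibilityCanonical := by
  intro hIn hmodP W _ _ p _ hp hX hs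
  have hES := hESc hIn
  have h422 : Literature.NumberTheory.EllipticCurves.BurungaleCastellaSkinner2025.prop422_greenbergAnyRoot_hasUnitContent_minus :=
    (show Literature.NumberTheory.EllipticCurves.BurungaleCastellaSkinner2025.prop422_greenbergAnyRoot_hasUnitContent_minus ∧
        Literature.NumberTheory.EllipticCurves.BurungaleSkinnerTianWan2024.props118_27_519_exists_signedTwoVariablePackage_supersingular_PRE
      from hIn).1
  obtain ⟨K, iF, iNF, ι, v, vbar, κ₁, κ₂, γ₁, γ₂, iPair, iD, N, iN, f, d, W', iE', iM', C, N', iN', f',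
      h0, h1, h2, h3, h4, h5, h6, h7, h8, h9, h10, h11, h12, h13, h14, h15, h16, h17, hcan,
      e1, e2, e3, e4, e5, e6, e7⟩ :=
    Summit.BirchSwinnertonDyer.BirchSwinnertonDyer.Theorems.SignedBaseChangeK1FrameDataCanonical.stub_frameDataBCSsplit_canonical
      hmodP W p hp hX hs
  have hgood : W.HasGoodReductionAtPrime p := hX.1.1
  have hgood' : W'.HasGoodReductionAtPrime p :=
    Summit.BirchSwinnertonDyer.BirchSwinnertonDyer.Theorems.SignedBaseChangeK2RFrames.hasGoodReductionAtPrime_of_smul_eq_quadraticTwist_of_not_ramifiedInQuadratic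
      W W' h7 Fact.out hgood (fun hr ↦ (h6 p Fact.out hr).1 rfl)
  have hs' : Literature.NumberTheory.EllipticCurves.Rank1Residual.Surj W' p :=
    SignedBaseChangeK1Acanchor.surj_of_smul_eq_quadraticTwist W W' p h5 h7 hs
  have h14' : IsCoprime (N' : ℤ) (NumberField.discr K) :=
    Summit.BirchSwinnertonDyer.BirchSwinnertonDyer.Theorems.SignedBaseChangeK2RFrames.isCoprime_conductorNorm_twist_discr
      W W' h7 h1 h3 (fun q hq hr ↦ ⟨(h6 q hq hr).2.1, (h6 q hq hr).2.2⟩) h14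
  have e1' := SignedBaseChangeK1Acanchor.heegner_twist W W' h7 h1 h3 (K := K) e1 e5 e2
  refine ⟨K, iF, iNF, ι, v, vbar, κ₁, κ₂, γ₁, γ₂, iPair, iD, N, iN, f, d, W', iE', iM', C, N', iN', f',
    h0, h1, h2, h3, h4, h5, h6, h7, h8, h9, h10, h11, h12, h13, h14, e1, e5, e2, h15, h16, h17, hcan, ?_⟩
  intro Ω δ Ωp LK G G' hΩ hδ hLK hG hG' J hJ
  have hA : (WeierstrassCurve.XGr₂.charIdeal (W.baseChange K) p κ₁ κ₂ vbar γ₁ γ₂).map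
      (IwasawaAlgebra₂.toUnr₂ p J) ≤ Ideal.span {G} :=
    map_le_span_of_residual_anchor (SignedBaseChangeK1Acanchor.charIdealIsPrincipal₂ p _) J
      (hES hmodP W p hp hgood hs K ι v vbar κ₁ κ₂ γ₁ γ₂ N f h0 h1 h8 h9 h10
        h11 h12 h13 h14 e1 e3.1 e3.2 h16 h17 Ω δ Ωp LK G hΩ hδ hLK hG J hJ)
      (stub_residualEisensteinInclusion hmodP W p hp hgood hs K ι v vbar κ₁ κ₂ γ₁ γ₂ N f h0 h1 h8 h9 h10
        h11 h12 h13 h14 e1 e3.1 e3.2 h16 h17 Ω δ Ωp LK G hΩ hδ hLK hG J hJ)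
      (residualNonvanishing_of_prop422 h422 hmodP W p hp hgood hs K ι v vbar κ₁ κ₂ γ₁ γ₂ N f h0 h1 h8 h9
        h10 h11 h12 h13 h14 e1 e3.1 e3.2 h16 h17 Ω δ Ωp LK G hΩ hδ hLK hG J hJ)
  have hB : (WeierstrassCurve.XGr₂.charIdeal (W'.baseChange K) p κ₁ κ₂ vbar γ₁ γ₂).map
      (IwasawaAlgebra₂.toUnr₂ p J) ≤ Ideal.span {G'} :=
    map_le_span_of_residual_anchor (SignedBaseChangeK1Acanchor.charIdealIsPrincipal₂ p _) J
      (hES hmodP W' p hp hgood' hs' K ι v vbar κ₁ κ₂ γ₁ γ₂ N' f' h2 h3 h8 h9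
        h10 h11 h12 h13 h14' e1' e3.1 e3.2 h16 h17 Ω δ Ωp LK G' hΩ hδ hLK hG' J hJ)
      (stub_residualEisensteinInclusion hmodP W' p hp hgood' hs' K ι v vbar κ₁ κ₂ γ₁ γ₂ N' f' h2 h3 h8 h9
        h10 h11 h12 h13 h14' e1' e3.1 e3.2 h16 h17 Ω δ Ωp LK G' hΩ hδ hLK hG' J hJ)
      (residualNonvanishing_of_prop422 h422 hmodP W' p hp hgood' hs' K ι v vbar κ₁ κ₂ γ₁ γ₂ N' f' h2 h3
        h8 h9 h10 h11 h12 h13 h14' e1' e3.1 e3.2 h16 h17 Ω δ Ωp LK G' hΩ hδ hLK hG' J hJ)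
  exact ⟨1, one_ne_zero, SignedBaseChangeK1Acanchor.span_C_one_mul_mul_le hA hB⟩



end Summit.BirchSwinnertonDyer.BirchSwinnertonDyer.Cruxes.TwistPairGreenbergProductDivisibilitySplit.Resmc
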